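import Literature.IUT.HodgeTheaters.FPrimeStripsRigidity
import Literature.AnabelianGeometry.AbsoluteAnabelian.ArchimedeanHolMonoidPairsLogFrobenius
import Literature.AnabelianGeometry.AbsoluteAnabelian.AbsTopIII.AutHolLogFrobeniusModelProofs
import Mathlib.CategoryTheory.HomCongr
import HarnessLib

/-!
# [IUTchI] Corollary 5.3 (ii), ARCHIMEDEAN model case in `FKit` currency from [AbsTopIII] Proposition 4.2 (i)
# — proof-only (L5 HUB row «C53ii/A1 EX34-HOLPAIR-TO-FKIT»)

S. Mochizuki, *Inter-universal Teichmüller theory I*, kurims manuscript (May 2020), §5, Corollary 5.3 (ii)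
p. 144 l. 14–18 («the natural map `Isom(¹𝔉, ²𝔉) → Isom(¹𝔇, ²𝔇)` is bijective»), proof p. 144 l. 36–39:
«Assertion (ii) … follows immediately from [AbsTopIII], Proposition 3.2, (iv); [AbsTopIII], Proposition 4.2,
(i) [cf. also [AbsTopIII], Remarks 3.1.1, 4.1.1; the discussion of Definition 5.2, (vi), (viii), of the present
paper]» ([IUTchI] Cor 5.3 (ii) p.144) [claim: Mochizuki2012, status: disputed] — cone node `IUTchI:Cor5.3(ii)`,
sub-DAG row C53ii/L06 (`v ∈ 𝕍^arc`: «`ℱ_v = (𝒞_v, 𝒟_v, κ_v)` (Ex 3.4 (i)); follows from [AbsTopIII] Prop 4.2 (i)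
[Rmk 4.1.1]») of HOME/plan …/SUBDAG-IUTchI-Cor53.md (abc-iut-L5-t4), discharger row «C53ii/A1» (holder
abc-iut-L4-t14) — the archimedean twin of abc-iut-w5-d175's nonarchimedean row «C53ii/N1»
(`FPrimeStripsModelInjectiveOfPairRigidity.lean`, whose idiom is followed).  S. Mochizuki, *Topics in absolute
anabelian geometry III*, Prop. 4.2 (i) p. 105: «Let `T ∈ {TM, TF, TLG, TCG}` … the natural functor of
Definition 4.1, (iii), induces a bijection `Isom_{𝒞^hol_T}((𝕏 ↶ M),(𝕏* ↶ M*)) ⥲ Isom_EA(𝕏, 𝕏*)` on sets of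
isomorphisms» [cite: MochizukiAbsTopIII2015, Proposition 4.2 (i) p.105] — PROVED in the tree at the MODEL of §4
over the [AbsTopIII] Cor. 2.7 (e) interface `𝔄 : AutHolFieldFunctor` (abc-iut-L4-t10 / abc-iut-w5-d226):
`HolMonoidPair.mapIso_toEA_bijective` (`T ∈ {TM, TLG, TCG}`), `HolTFPair.mapIso_toEA_bijective` (`T = TF`);
Rmk. 4.1.1 p. 105: «The topological monoid "`𝒪^⊳_k`" associated to a CAF `k` is essentially the data used to
construct the archimedean Frobenioids of [FrdII], Example 3.3, (ii)» [cite: MochizukiAbsTopIII2015,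
Remark 4.1.1 p.105]; [IUTchI] Ex. 3.4 (i) p. 80: «one may also think of `𝒞_v` as a "Frobenioid-theoretic
representation" of the topological monoid `𝒪^⊳_{K_v}` [cf. [AbsTopIII], Remark 4.1.1]»; Def. 5.2 (viii) p. 140:
«the Kummer structure portion of `‡ℱ_v` may be regarded as an isomorphism of topological monoids
`M_v(‡𝒟_v) ⥲ ‡M_v`».

WHAT IS PROVED HERE (theorems only; no `def`, no `instance`; nothing of the series asserted).  abc-iut-L5-t4's
`PMBaseKit.FKit` types the `ℱ`-prime-strip slots abstractly (`FAmb v`, `fModel v`, `toD v : FAmb v ⥤ Amb v`; at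
`v ∈ 𝕍^arc` the objects are «triples `(𝒞_v, 𝒟_v, κ_v)` consisting of a category, an Aut-holomorphic orbispace, and
a Kummer structure and isomorphisms of collections of data», Def 5.2 (i) (b)), and `isomFtoDBijective_iff_model`
(p409092) reduces Cor 5.3 (ii) to the MODEL CASE `Function.Bijective fun α : ℱ_v ≅ ℱ_v => (toD v).mapIso α` at
each `v`.  For an archimedean slot PRESENTED OVER the Aut-holomorphic `T`-pairs of [AbsTopIII] Def. 4.1 — a
functor `ι : FAmb v ⥤ HolMonoidPair 𝔄 T` (`T ∈ {TM, TLG, TCG}`; at the Ex 3.4 (i) datum `T = TM`: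
`‡ℱ_v = (‡𝒞_v, ‡𝒟_v, ‡κ_v) ↦ (‡𝒟_v ↶ 𝒪^⊳(‡𝒞_v))` with Kummer structure `‡κ_v`), resp. `ι : FAmb v ⥤ HolTFPair 𝔄` —
and a base functor `toD v` («`ℱ_v ↦ 𝒟_v`», Rmk 5.2.1 (i)) that READS THE `EA` COMPONENT:

* INJECTIVITY half (`Cor53ii.mapIso_injective_of_readsEA`, `…_TF`; `FKit.model_injective_of_readsEA`): from `ι`
  FAITHFUL alone — an isomorphism of pairs is determined by its structure part (`HolMonoidPair.Hom.ext_of_base`,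
  `HolTFPair.Hom.ext_of_base`, BY NAME);
* full BIJECTIVITY (`Cor53ii.mapIso_bijective_of_holPairPresentation`, `…_TF`;
  `FKit.model_bijective_of_holPairPresentation`, `…_TF`): from [AbsTopIII] Prop 4.2 (i)
  (`HolMonoidPair.mapIso_toEA_bijective` / `HolTFPair.mapIso_toEA_bijective`, BY NAME), MODULO EXACTLY two displayed
  hypotheses — (R) «`ι` is bijective on isomorphisms» at the objects concerned, i.e. the [AbsTopIII] Rmk 4.1.1 /
  [IUTchI] Def 5.2 (viii) layer (an isomorphism of collections of data `(‡𝒞_v, ‡𝒟_v, ‡κ_v) ⥲ (⋯)` is determined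
  by, and every isomorphism of the underlying Aut-holomorphic `TM`-pairs lifts to, one: the archimedean-Frobenioid
  analogue of the nonarchimedean rows C53ii/N2, C53iv/S2 — [FrdI] Thm 3.4 (iii) / [FrdII] Ex 3.3 territory of
  layer L1, NOT proved here and NOT minted as a named fact), and (E) a natural isomorphism
  `ι ⋙ (𝒞^hol_T → EA) ⋙ E ≅ toD v` through a functor `E : EA ⥤ Amb v` bijective on the isomorphisms concerned
  (the genuine base kit's archimedean slot «isomorphs of `𝒟_v`»);
* the generic bookkeeping used (`Cor53ii.mapIso_bijective_comp`, `…_injective_comp`, `…_bijective_congr`,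
  `…_injective_congr`, `…_bijective_id`): bijectivity/injectivity on isomorphisms composes along functors and
  transfers along natural isomorphisms;
* non-vacuity of (R)+(E) at the pair category itself (`ι = 𝟭`, `E = 𝟭`): `Cor53ii.mapIso_bijective_toEA_comp`.

NOT touched: the nonarchimedean thirds (rows N1–N3, S2); the OBJECT-level adapter from abc-iut-L5-t2's Ex 3.4 (i)
interface `ArchLocalFrobenioid` to `HolTFPair` / `HolMonoidPair .TM` (row «C53ii/A2», separate file); the genuine
kit.  HONEST FRAMING: elementary category-theoretic bookkeeping over OUR typed interfaces plus one refereed 2015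
statement already kernel-checked in the tree at its model; no side taken on [IUTchIII] Cor. 3.12; nothing here
asserts abc proved or refuted; typed ≠ proved for the interfaces themselves.
-/

namespace Literature.IUT.HodgeTheaters

open CategoryTheory
open Literature.AnabelianGeometry.AbsoluteAnabelian

universe v₁ u₁ v₂ u₂ v₃ u₃ u

namespace Cor53ii

/-! ### Generic bookkeeping: bijectivity on isomorphisms composes and transfers along natural isomorphisms -/

section Generic

variable {C : Type u₁} [Category.{v₁} C] {D : Type u₂} [Category.{v₂} D] {E : Type u₃} [Category.{v₃} E]

/-- `(F ⋙ G)(α) = G(F(α))` on isomorphisms (bookkeeping). ([IUTchI] Cor 5.3 (ii) p.144) [claim: Mochizuki2012, status: disputed] -/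
theorem comp_mapIso_eq (F : C ⥤ D) (G : D ⥤ E) {X Y : C} (α : X ≅ Y) :
    (F ⋙ G).mapIso α = G.mapIso (F.mapIso α) := Iso.ext rfl

/-- If `α ↦ F(α)` is injective on `Isom(X, Y)` and `β ↦ G(β)` is injective on `Isom(F X, F Y)`, then
`α ↦ (F ⋙ G)(α)` is injective on `Isom(X, Y)`. ([IUTchI] Cor 5.3 (ii) p.144) [claim: Mochizuki2012, status: disputed] -/
theorem mapIso_injective_comp (F : C ⥤ D) (G : D ⥤ E) {X Y : C}
    (hF : Function.Injective fun α : X ≅ Y => F.mapIso α)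
    (hG : Function.Injective fun β : F.obj X ≅ F.obj Y => G.mapIso β) :
    Function.Injective fun α : X ≅ Y => (F ⋙ G).mapIso α := by
  have h : (fun α : X ≅ Y => (F ⋙ G).mapIso α) =
      (fun β : F.obj X ≅ F.obj Y => G.mapIso β) ∘ fun α : X ≅ Y => F.mapIso α :=
    funext fun α => comp_mapIso_eq F G α
  rw [h]
  exact hG.comp hF

/-- If `α ↦ F(α)` is bijective on `Isom(X, Y)` and `β ↦ G(β)` is bijective on `Isom(F X, F Y)`, then
`α ↦ (F ⋙ G)(α)` is bijective on `Isom(X, Y)`. ([IUTchI] Cor 5.3 (ii) p.144) [claim: Mochizuki2012, status: disputed] -/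
theorem mapIso_bijective_comp (F : C ⥤ D) (G : D ⥤ E) {X Y : C}
    (hF : Function.Bijective fun α : X ≅ Y => F.mapIso α)
    (hG : Function.Bijective fun β : F.obj X ≅ F.obj Y => G.mapIso β) :
    Function.Bijective fun α : X ≅ Y => (F ⋙ G).mapIso α := by
  have h : (fun α : X ≅ Y => (F ⋙ G).mapIso α) =
      (fun β : F.obj X ≅ F.obj Y => G.mapIso β) ∘ fun α : X ≅ Y => F.mapIso α :=
    funext fun α => comp_mapIso_eq F G α
  rw [h]
  exact hG.comp hF

/-- Along a natural isomorphism `e : F ≅ F'`, `F'(α) = e_X⁻¹ ∘ F(α) ∘ e_Y` on isomorphisms (bookkeeping).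
([IUTchI] Cor 5.3 (ii) p.144) [claim: Mochizuki2012, status: disputed] -/
theorem mapIso_eq_isoCongr {F F' : C ⥤ D} (e : F ≅ F') {X Y : C} (α : X ≅ Y) :
    F'.mapIso α = Iso.isoCongr (e.app X) (e.app Y) (F.mapIso α) := by
  ext
  rw [Iso.isoCongr_apply]
  change F'.map α.hom = (e.app X).inv ≫ F.map α.hom ≫ (e.app Y).hom
  rw [Iso.app_inv, Iso.app_hom, NatIso.naturality_1]

/-- Injectivity on `Isom(X, Y)` transfers along a natural isomorphism `F ≅ F'`.
([IUTchI] Cor 5.3 (ii) p.144) [claim: Mochizuki2012, status: disputed] -/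
theorem mapIso_injective_congr {F F' : C ⥤ D} (e : F ≅ F') {X Y : C}
    (hF : Function.Injective fun α : X ≅ Y => F.mapIso α) :
    Function.Injective fun α : X ≅ Y => F'.mapIso α := by
  have h : (fun α : X ≅ Y => F'.mapIso α) =
      (Iso.isoCongr (e.app X) (e.app Y)) ∘ fun α : X ≅ Y => F.mapIso α :=
    funext fun α => mapIso_eq_isoCongr e α
  rw [h]
  exact (Iso.isoCongr (e.app X) (e.app Y)).injective.comp hF

/-- Bijectivity on `Isom(X, Y)` transfers along a natural isomorphism `F ≅ F'`.
([IUTchI] Cor 5.3 (ii) p.144) [claim: Mochizuki2012, status: disputed] -/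
theorem mapIso_bijective_congr {F F' : C ⥤ D} (e : F ≅ F') {X Y : C}
    (hF : Function.Bijective fun α : X ≅ Y => F.mapIso α) :
    Function.Bijective fun α : X ≅ Y => F'.mapIso α := by
  have h : (fun α : X ≅ Y => F'.mapIso α) =
      (Iso.isoCongr (e.app X) (e.app Y)) ∘ fun α : X ≅ Y => F.mapIso α :=
    funext fun α => mapIso_eq_isoCongr e α
  rw [h]
  exact (Iso.isoCongr (e.app X) (e.app Y)).bijective.comp hF

/-- The identity functor is bijective on isomorphisms (used to discharge the presentation hypotheses at the
pair category itself). ([IUTchI] Cor 5.3 (ii) p.144) [claim: Mochizuki2012, status: disputed] -/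
theorem mapIso_bijective_id (X Y : C) : Function.Bijective fun α : X ≅ Y => (𝟭 C).mapIso α := by
  have h : (fun α : X ≅ Y => (𝟭 C).mapIso α) = id := funext fun α => Iso.ext rfl
  rw [h]
  exact Function.bijective_id

/-- A faithful functor is injective on isomorphisms. ([IUTchI] Cor 5.3 (ii) p.144) [claim: Mochizuki2012, status: disputed] -/
theorem mapIso_injective_of_faithful (F : C ⥤ D) [F.Faithful] (X Y : C) :
    Function.Injective fun α : X ≅ Y => F.mapIso α :=
  fun _ _ h => Iso.ext (F.map_injective (congrArg Iso.hom h))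

/-- A fully faithful functor is bijective on isomorphisms. ([IUTchI] Cor 5.3 (ii) p.144) [claim: Mochizuki2012, status: disputed] -/
theorem mapIso_bijective_of_fullyFaithful {F : C ⥤ D} (hF : F.FullyFaithful) (X Y : C) :
    Function.Bijective fun α : X ≅ Y => F.mapIso α :=
  (hF.isoEquiv (X := X) (Y := Y)).bijective

end Generic

/-! ### Pair-category level ([AbsTopIII] Prop 4.2 (i)): functors presented over `𝒞^hol_T`, `T ∈ {TM, TLG, TCG}` -/

section Monoid

variable {𝔄 : AutHolFieldFunctor.{u}} {T : ArchPairType}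
variable {C : Type u₁} [Category.{v₁} C] {D : Type u₂} [Category.{v₂} D]

/-- **Cor 5.3 (ii), archimedean model case, INJECTIVITY — functor form.**  Let `C` be any category of
(isomorphs of) archimedean collections of data presented by a FAITHFUL functor `ι : C ⥤ 𝒞^hol_T`
(`HolMonoidPair 𝔄 T`, `T ∈ {TM, TLG, TCG}`; Rmk 4.1.1: `‡ℱ_v ↦ (‡𝒟_v ↶ 𝒪^⊳(‡𝒞_v))`), and `G : C ⥤ D` any functor that
READS THE `EA` COMPONENT (`hG`: morphisms with the same image under `G` have the same structure part `φ_𝕏` under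
`ι`) — the shape of «`ℱ_v ↦ 𝒟_v`» (Rmk 5.2.1 (i); [AbsTopIII] Def 4.1 (iii) «`(𝕏 ↶ M) ↦ 𝕏`»).  Then `α ↦ G(α)` is
injective on `Isom(X, Y)`: a morphism of Aut-holomorphic `T`-pairs is determined by its structure part
(`HolMonoidPair.Hom.ext_of_base`, the injectivity portion of Prop 4.2 (i)).
([IUTchI] Cor 5.3 (ii) p.144) [claim: Mochizuki2012, status: disputed] -/
theorem mapIso_injective_of_readsEA (ι : C ⥤ HolMonoidPair 𝔄 T) [ι.Faithful] (G : C ⥤ D)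
    (hG : ∀ {X Y : C} (f g : X ⟶ Y), G.map f = G.map g → (ι.map f).base = (ι.map g).base) (X Y : C) :
    Function.Injective fun α : X ≅ Y => G.mapIso α := by
  intro α₁ α₂ hα
  have h1 : G.map α₁.hom = G.map α₂.hom := congrArg Iso.hom hα
  have h2 : ι.map α₁.hom = ι.map α₂.hom := HolMonoidPair.Hom.ext_of_base (hG _ _ h1)
  exact Iso.ext (ι.map_injective h2)

variable (𝔄 T) in
/-- **[AbsTopIII] Prop 4.2 (i) composed with a base presentation**: for `E : EA ⥤ D` bijective on
`Isom(𝕏, 𝕏*)`, the functor `(𝕏 ↶ M) ↦ E(𝕏)` is bijective on `Isom((𝕏 ↶ M), (𝕏* ↶ M*))` (`T ∈ {TM, TLG, TCG}`) — the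
presentation hypotheses of `mapIso_bijective_of_holPairPresentation` hold at the pair category itself (`ι = 𝟭`).
[cite: MochizukiAbsTopIII2015, Proposition 4.2 (i) p.105] -/
theorem mapIso_bijective_toEA_comp (E : 𝔄.EA ⥤ D) (P Q : HolMonoidPair 𝔄 T)
    (hE : Function.Bijective fun β : P.X ≅ Q.X => E.mapIso β) :
    Function.Bijective fun α : P ≅ Q => (HolMonoidPair.toEA 𝔄 T ⋙ E).mapIso α :=
  mapIso_bijective_comp (HolMonoidPair.toEA 𝔄 T) E (HolMonoidPair.mapIso_toEA_bijective P Q) hE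

/-- **Cor 5.3 (ii), archimedean model case, BIJECTIVITY — functor form** («follows immediately from [AbsTopIII],
Proposition 4.2, (i) [cf. Remark 4.1.1]»).  Let `ι : C ⥤ 𝒞^hol_T` present a category of archimedean collections of
data over the Aut-holomorphic `T`-pairs (`T ∈ {TM, TLG, TCG}`) and let `G : C ⥤ D` be, up to a natural isomorphism
`e`, the composite `C → 𝒞^hol_T → EA → D` through a functor `E` («`ℱ_v ↦ 𝒟_v`» followed by the inclusion of `EA`
into the ambient category of isomorphs of `𝒟_v`).  If (R) `ι` is bijective on `Isom(X, Y)` — the Rmk 4.1.1 /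
Def 5.2 (viii) layer: an isomorphism of collections of data is determined by, and every isomorphism of the
underlying `T`-pairs lifts to, one — and (E) `E` is bijective on `Isom(𝕏, 𝕏*)`, then `α ↦ G(α)` is bijective on
`Isom(X, Y)`; the middle step is [AbsTopIII] Prop 4.2 (i) (`HolMonoidPair.mapIso_toEA_bijective`, PROVED, BY NAME).
([IUTchI] Cor 5.3 (ii) p.144) [claim: Mochizuki2012, status: disputed] -/
theorem mapIso_bijective_of_holPairPresentation (ι : C ⥤ HolMonoidPair 𝔄 T) (E : 𝔄.EA ⥤ D) {G : C ⥤ D}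
    (e : (ι ⋙ HolMonoidPair.toEA 𝔄 T) ⋙ E ≅ G) {X Y : C}
    (hι : Function.Bijective fun α : X ≅ Y => ι.mapIso α)
    (hE : Function.Bijective fun β : (ι.obj X).X ≅ (ι.obj Y).X => E.mapIso β) :
    Function.Bijective fun α : X ≅ Y => G.mapIso α :=
  mapIso_bijective_congr e
    (mapIso_bijective_comp (ι ⋙ HolMonoidPair.toEA 𝔄 T) E
      (mapIso_bijective_comp ι (HolMonoidPair.toEA 𝔄 T) hι (HolMonoidPair.mapIso_toEA_bijective _ _)) hE)

/-- The same with (R) and (E) supplied by FULLY FAITHFUL functors `ι`, `E` (the strongest and simplest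
sufficient form: `C` a full subcategory of isomorphs inside `𝒞^hol_T`, `EA` a full subcategory of the ambient
category of the base slot). ([IUTchI] Cor 5.3 (ii) p.144) [claim: Mochizuki2012, status: disputed] -/
theorem mapIso_bijective_of_fullyFaithful_presentation {ι : C ⥤ HolMonoidPair 𝔄 T} (hι : ι.FullyFaithful)
    {E : 𝔄.EA ⥤ D} (hE : E.FullyFaithful) {G : C ⥤ D} (e : (ι ⋙ HolMonoidPair.toEA 𝔄 T) ⋙ E ≅ G) (X Y : C) :
    Function.Bijective fun α : X ≅ Y => G.mapIso α :=
  mapIso_bijective_of_holPairPresentation ι E e (mapIso_bijective_of_fullyFaithful hι X Y)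
    (mapIso_bijective_of_fullyFaithful hE _ _)

end Monoid

/-! ### Pair-category level, `T = TF` (`𝒞^hol_TF = HolTFPair 𝔄`, abc-iut-L4-t10) -/

section Field

variable {𝔄 : AutHolFieldFunctor.{u}}
variable {C : Type u₁} [Category.{v₁} C] {D : Type u₂} [Category.{v₂} D]

/-- `T = TF` twin of `mapIso_injective_of_readsEA`: a functor presented faithfully over `𝒞^hol_TF` and reading the
`EA` component is injective on isomorphisms (`HolTFPair.Hom.ext_of_base`).
([IUTchI] Cor 5.3 (ii) p.144) [claim: Mochizuki2012, status: disputed] -/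
theorem mapIso_injective_of_readsEA_TF (ι : C ⥤ HolTFPair 𝔄) [ι.Faithful] (G : C ⥤ D)
    (hG : ∀ {X Y : C} (f g : X ⟶ Y), G.map f = G.map g → (ι.map f).base = (ι.map g).base) (X Y : C) :
    Function.Injective fun α : X ≅ Y => G.mapIso α := by
  intro α₁ α₂ hα
  have h1 : G.map α₁.hom = G.map α₂.hom := congrArg Iso.hom hα
  have h2 : ι.map α₁.hom = ι.map α₂.hom := HolTFPair.Hom.ext_of_base (hG _ _ h1)
  exact Iso.ext (ι.map_injective h2)

variable (𝔄) in
/-- `T = TF` twin of `mapIso_bijective_toEA_comp`: `(𝕏 ↶ k) ↦ E(𝕏)` is bijective on isomorphisms for `E` bijective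
on `Isom(𝕏, 𝕏*)` ([AbsTopIII] Prop 4.2 (i) at `𝒞^hol_TF`, `HolTFPair.mapIso_toEA_bijective`).
[cite: MochizukiAbsTopIII2015, Proposition 4.2 (i) p.105] -/
theorem mapIso_bijective_toEA_comp_TF (E : 𝔄.EA ⥤ D) (P Q : HolTFPair 𝔄)
    (hE : Function.Bijective fun β : P.X ≅ Q.X => E.mapIso β) :
    Function.Bijective fun α : P ≅ Q => (HolTFPair.toEA 𝔄 ⋙ E).mapIso α :=
  mapIso_bijective_comp (HolTFPair.toEA 𝔄) E (HolTFPair.mapIso_toEA_bijective P Q) hE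

/-- `T = TF` twin of `mapIso_bijective_of_holPairPresentation`: bijectivity on isomorphisms for a functor that
is, up to natural isomorphism, `C → 𝒞^hol_TF → EA → D`, modulo (R) `ι` bijective on `Isom(X, Y)` and (E) `E`
bijective on `Isom(𝕏, 𝕏*)`; middle step `HolTFPair.mapIso_toEA_bijective` (BY NAME).
([IUTchI] Cor 5.3 (ii) p.144) [claim: Mochizuki2012, status: disputed] -/
theorem mapIso_bijective_of_holPairPresentation_TF (ι : C ⥤ HolTFPair 𝔄) (E : 𝔄.EA ⥤ D) {G : C ⥤ D}
    (e : (ι ⋙ HolTFPair.toEA 𝔄) ⋙ E ≅ G) {X Y : C}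
    (hι : Function.Bijective fun α : X ≅ Y => ι.mapIso α)
    (hE : Function.Bijective fun β : (ι.obj X).X ≅ (ι.obj Y).X => E.mapIso β) :
    Function.Bijective fun α : X ≅ Y => G.mapIso α :=
  mapIso_bijective_congr e
    (mapIso_bijective_comp (ι ⋙ HolTFPair.toEA 𝔄) E
      (mapIso_bijective_comp ι (HolTFPair.toEA 𝔄) hι (HolTFPair.mapIso_toEA_bijective _ _)) hE)

end Field

end Cor53ii

/-! ### `FKit` currency -/

namespace PMBaseKit

namespace FKit

universe w

variable {l : ℕ} {K : PMBaseKit.{w} l} {M : K.MultKit} {FK : K.FKit M}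
variable {𝔄 : AutHolFieldFunctor.{u}} {T : ArchPairType}

/-- **Row C53ii/A1 «EX34-HOLPAIR-TO-FKIT», injectivity half of the hypothesis `h v` of
`isomFtoDBijective_of_model`, for an archimedean slot presented over Aut-holomorphic `T`-pairs.**  Let `v` be an
index of abc-iut-L5-t4's `ℱ`-prime-strip kit whose ambient category `FAmb v` («triples `(𝒞_v, 𝒟_v, κ_v)` … and
isomorphisms of collections of data», Def 5.2 (i) (b)) is presented by a FAITHFUL functor
`ι : FAmb v ⥤ HolMonoidPair 𝔄 T` (Rmk 4.1.1 / Def 5.2 (viii): `‡ℱ_v ↦ (‡𝒟_v ↶ 𝒪^⊳(‡𝒞_v))`, `T = TM`) and whose base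
functor `toD v` («`ℱ_v ↦ 𝒟_v`», Rmk 5.2.1 (i)) READS THE `EA` COMPONENT (`hG`).  Then
`Isom(ℱ_v, ℱ_v) → Isom(𝒟_v, 𝒟_v)`, `α ↦ (toD v)(α)`, is INJECTIVE on the model object — the injectivity portion of
[AbsTopIII] Prop. 4.2 (i) via `HolMonoidPair.Hom.ext_of_base` (BY NAME).
([IUTchI] Cor 5.3 (ii) p.144) [claim: Mochizuki2012, status: disputed] -/
theorem model_injective_of_readsEA (v : K.V) (ι : FK.FAmb v ⥤ HolMonoidPair 𝔄 T) [ι.Faithful]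
    (hG : ∀ {X Y : FK.FAmb v} (f g : X ⟶ Y),
      (FK.toD v).map f = (FK.toD v).map g → (ι.map f).base = (ι.map g).base) :
    Function.Injective fun α : FK.fModel v ≅ FK.fModel v => (FK.toD v).mapIso α :=
  Cor53ii.mapIso_injective_of_readsEA ι (FK.toD v) (fun f g h => hG f g h) _ _

/-- `T = TF` twin of `model_injective_of_readsEA` (slot presented faithfully over `𝒞^hol_TF = HolTFPair 𝔄`).
([IUTchI] Cor 5.3 (ii) p.144) [claim: Mochizuki2012, status: disputed] -/
theorem model_injective_of_readsEA_TF (v : K.V) (ι : FK.FAmb v ⥤ HolTFPair 𝔄) [ι.Faithful]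
    (hG : ∀ {X Y : FK.FAmb v} (f g : X ⟶ Y),
      (FK.toD v).map f = (FK.toD v).map g → (ι.map f).base = (ι.map g).base) :
    Function.Injective fun α : FK.fModel v ≅ FK.fModel v => (FK.toD v).mapIso α :=
  Cor53ii.mapIso_injective_of_readsEA_TF ι (FK.toD v) (fun f g h => hG f g h) _ _

/-- **Row C53ii/A1 «EX34-HOLPAIR-TO-FKIT», the full model case `h v` of `isomFtoDBijective_of_model` at an
archimedean slot.**  If the slot `FAmb v` is presented over `𝒞^hol_T` by `ι` (`T ∈ {TM, TLG, TCG}`), the base functor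
`toD v` is — up to a natural isomorphism `e` — the composite `FAmb v → 𝒞^hol_T → EA → Amb v` through a functor
`E : EA ⥤ Amb v`, and (R) `ι` is bijective on `Isom(ℱ_v, ℱ_v)` ([AbsTopIII] Rmk 4.1.1 / [IUTchI] Def 5.2 (viii) layer,
hypothesis), (E) `E` is bijective on `Isom(𝒟_v, 𝒟_v)` (genuine base slot, hypothesis), then
`Isom(ℱ_v, ℱ_v) → Isom(𝒟_v, 𝒟_v)`, `α ↦ (toD v)(α)`, is BIJECTIVE — «follows immediately from [AbsTopIII],
Proposition 4.2, (i)» (`HolMonoidPair.mapIso_toEA_bijective`, PROVED, BY NAME).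
([IUTchI] Cor 5.3 (ii) p.144) [claim: Mochizuki2012, status: disputed] -/
theorem model_bijective_of_holPairPresentation (v : K.V) (ι : FK.FAmb v ⥤ HolMonoidPair 𝔄 T)
    (E : 𝔄.EA ⥤ K.Amb v) (e : (ι ⋙ HolMonoidPair.toEA 𝔄 T) ⋙ E ≅ FK.toD v)
    (hι : Function.Bijective fun α : FK.fModel v ≅ FK.fModel v => ι.mapIso α)
    (hE : Function.Bijective
      fun β : (ι.obj (FK.fModel v)).X ≅ (ι.obj (FK.fModel v)).X => E.mapIso β) :
    Function.Bijective fun α : FK.fModel v ≅ FK.fModel v => (FK.toD v).mapIso α :=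
  Cor53ii.mapIso_bijective_of_holPairPresentation ι E e hι hE

/-- The same at ANY two objects of such a slot (not only the model), for use with abc-iut-L5-t4's transport
lemma `mapIso_bijective_of_model` or directly. ([IUTchI] Cor 5.3 (ii) p.144) [claim: Mochizuki2012, status: disputed] -/
theorem mapIso_bijective_of_holPairPresentation (v : K.V) (ι : FK.FAmb v ⥤ HolMonoidPair 𝔄 T)
    (E : 𝔄.EA ⥤ K.Amb v) (e : (ι ⋙ HolMonoidPair.toEA 𝔄 T) ⋙ E ≅ FK.toD v) {X Y : FK.FAmb v}
    (hι : Function.Bijective fun α : X ≅ Y => ι.mapIso α)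
    (hE : Function.Bijective fun β : (ι.obj X).X ≅ (ι.obj Y).X => E.mapIso β) :
    Function.Bijective fun φ : X ≅ Y => (FK.toD v).mapIso φ :=
  Cor53ii.mapIso_bijective_of_holPairPresentation ι E e hι hE

/-- The strongest sufficient form: `ι` and `E` FULLY FAITHFUL (`FAmb v` a full subcategory of isomorphs inside
`𝒞^hol_T`, `EA` fully faithfully inside `Amb v`) give the model case `h v` outright.
([IUTchI] Cor 5.3 (ii) p.144) [claim: Mochizuki2012, status: disputed] -/
theorem model_bijective_of_fullyFaithful_presentation (v : K.V) {ι : FK.FAmb v ⥤ HolMonoidPair 𝔄 T}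
    (hι : ι.FullyFaithful) {E : 𝔄.EA ⥤ K.Amb v} (hE : E.FullyFaithful)
    (e : (ι ⋙ HolMonoidPair.toEA 𝔄 T) ⋙ E ≅ FK.toD v) :
    Function.Bijective fun α : FK.fModel v ≅ FK.fModel v => (FK.toD v).mapIso α :=
  Cor53ii.mapIso_bijective_of_fullyFaithful_presentation hι hE e _ _

/-- `T = TF` twin of `model_bijective_of_holPairPresentation` (slot presented over `𝒞^hol_TF = HolTFPair 𝔄`;
middle step `HolTFPair.mapIso_toEA_bijective`). ([IUTchI] Cor 5.3 (ii) p.144) [claim: Mochizuki2012, status: disputed] -/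
theorem model_bijective_of_holPairPresentation_TF (v : K.V) (ι : FK.FAmb v ⥤ HolTFPair 𝔄)
    (E : 𝔄.EA ⥤ K.Amb v) (e : (ι ⋙ HolTFPair.toEA 𝔄) ⋙ E ≅ FK.toD v)
    (hι : Function.Bijective fun α : FK.fModel v ≅ FK.fModel v => ι.mapIso α)
    (hE : Function.Bijective
      fun β : (ι.obj (FK.fModel v)).X ≅ (ι.obj (FK.fModel v)).X => E.mapIso β) :
    Function.Bijective fun α : FK.fModel v ≅ FK.fModel v => (FK.toD v).mapIso α :=
  Cor53ii.mapIso_bijective_of_holPairPresentation_TF ι E e hι hE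

end FKit

end PMBaseKit

end Literature.IUT.HodgeTheaters
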